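import Mathlib
import HarnessLib
import Summits.HubbardSuperconductivity.HubbardSuperconductivity.Theses.KLProgramme
import Summits.HubbardSuperconductivity.HubbardSuperconductivity.Theorems.KLProgrammeKLRegimeBetaSplitV12

/-!
# Route `KLProgramme` — crux K3 gen 4, child 1 `KLRegimeBetaSplitV12 := BetaSplitP klPredsV12 klWindowC` (stmt-HubbardSuperconductivity-19856) CLOSED

Cell gate-hubbard-kl, seat hubbard-kl-k3c1-p2 (child-1 re-closure owner on gen 4; Δ21 = signed slice pair-bubble weights, bundle V12 p470806).
The route decl BY NAME, from `betaSplitP_klPredsV12` (`…KLRegimeBetaSplitV12`: `betaSplitP_of_slotsV8S` ← `betaSplitP_of_edgeClauses` ←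
`pairArray_envelope_edge` ← `pairLadder_envelope_edge` ← `sWaveCascade_envelope_edge`).  One line.
-/

noncomputable section

namespace Summit.HubbardSuperconductivity.HubbardSuperconductivity.Theorems

set_option linter.dupNamespace false -- summit = problem name (single-conjunct summit), D-0017

/-- **Gen-4 child 1 of K3 holds**: `KLRegimeBetaSplitV12` (= `BetaSplitP klPredsV12 klWindowC`), by `KLRegimeSplit.betaSplitP_klPredsV12`. -/
theorem klRegimeBetaSplitV12_proof : Summit.HubbardSuperconductivity.HubbardSuperconductivity.Theses.KLProgramme.KLRegimeBetaSplitV12 :=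
  KLRegimeSplit.betaSplitP_klPredsV12 KLRegimeSplit.klWindowC

end Summit.HubbardSuperconductivity.HubbardSuperconductivity.Theorems

end
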